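import Literature.NumberTheory.Automorphic.ArchChartNormPairs                 -- ★ §1 `isConj_iff_forall_place`, `isConj_iff_exists_perm_of_eq_conj_diagonal`, `isConj_units_iff_coe`; §2 `coe_gprimeSplitGL_eq_conj_diagonal`, `isUnit_det_cayB_submatrix`
import Literature.NumberTheory.Automorphic.ArchInnerFormChartExhaustion        -- ★ (EXH-G′) `exists_conj_gprimeTorus_of_isRegularElt`, `mem_unitaryGroupOfForm_formRe_of_mem_archLocal`, `norm_exp_ofReal_add_ofReal_mul_I`
import Literature.NumberTheory.Rogawski1990.ArchInnerTransferCongruence        -- ★ (T-d) FILE 2 `corresponds_archCongr_right_iff`, `isRegularElt_coe_archCongr_iff`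
import Literature.NumberTheory.Automorphic.ArchCongruenceOrbitalTransport      -- ★ (T-d) FILE 1 `coe_archCongrOfEq_apply`, `formCongr_quasiSplitFrame_diagonal`, the `quasiSplitWeights` guards
import Literature.NumberTheory.Rogawski1990.ArchDefinitePlaceNoSplitPartner    -- ★ §1 `norm_eq_one_of_isRoot_charpoly_of_mem_unitaryGroupOfForm_of_posDef ∕ _of_neg_posDef`; brings ★ `charpoly_archPiEquivCM_eq_of_corresponds`
import HarnessLib

/-!
# The inner-twist chart dictionary `γ′ ↔ γ` between the Cartan atlases of `G′_∞ = U(diag α)(L⁺ ⊗ ℝ)` and of the quasi-split `G_∞ = U(Φ₃)(L⁺ ⊗ ℝ) ≅ U(diag(½,1,−½))(L⁺ ⊗ ℝ)`,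
# and the vanishing clause «no partner at a definite place» (N8-INNER brick (3); Rogawski 1990 §14.1–14.2 (14.2.1), §3.1, §3.6; Shelstad 1979 §4)

Topic `NumberTheory/Rogawski1990`; namespace `Literature.NumberTheory.Rogawski1990`.  THEOREMS ONLY (no `def`, no instance, no notation, no axiom, no named fact,
no `sorry`).  Cell `pub/hodgecm-mathlib`, crux H413 (`stmt-HodgeConjecture-24833`), half-A line LH2, road «N8-INNER» (LEAD T14-4 (L2); census `N8-ROAD-CENSUS v0`
§2 row 5 «INNER-TWIST DICTIONARY `γ′ ↔ γ` in chart coordinates; the vanishing clause», §5 (3)); dealt by the road owner LH2-plan (g1) DEAL #1 to seat LH7-p04 (g8);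
census-first by LH7-p01 (g7) (`CENSUS-N8-brick3-dictionary.v1`, sha16 caefa37a7656b48f), whose head shapes are followed here.  Count-neutral bookkeeping (lane
`--supports`); pays no organ by itself.

THE MATHEMATICS.  The relation (14.2.1) ★ `IsArchInnerTransfer L H′ m′ m a′ a` compares stable orbital integrals on `G_∞` and `G′_∞` along the correspondence
★ `Corresponds (c ⊗ 1) (H′ ⊗ 1) (Φ₃ ⊗ 1) γ′ γ` = «`γ′` and `γ` are conjugate in the common ambient `GL₃(L ⊗ ℝ)`» [Rogawski1990, §14.1 p. 232: «the conjugacy class of `ψ(γ′)`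
intersects `G` in a stable conjugacy class»; §3.1 p. 19: stable conjugacy = conjugacy over `F̄`, here = `GL₃`-conjugacy], with two branches at a regular `γ`: (i) `Φ^st(γ, a) = Φ^st(γ′, a′)`
for every `γ′ ↔ γ`, (ii) `Φ^st(γ, a) = 0` when NO `γ′` corresponds («`γ` does not occur in `G′`» — at a place `v ∈ S₀` where `G′_v ≅ U₃(ℝ)` is compact only elliptic classes occur
[§14.2 pp. 232–233]).  Both atlases are the ★ Cartan atlas `gprimeTorus L δ S c` (`ArchInnerFormCartanAtlas`) of a DIAGONAL form `diag δ`: `δ = α` for the inner form, `δ = β₀ =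
(½, 1, −½)` for `G_∞`, moved to the literal `Φ₃` carrier by the rational congruence ★ `formCongr_quasiSplitFrame_diagonal` (`Qᵀ·diag β₀·Q = Φ₃`), i.e. by `Ψ_Q : U(Φ₃)(L ⊗ ℝ) ≃ₜ*
U(diag β₀)(L ⊗ ℝ)`, `g ↦ (Q ⊗ 1) g (Q ⊗ 1)⁻¹` (★ `coe_archCongrOfEq_apply`).  As in the (T-d) files the `Φ₃`-side statements are made for an ABSTRACT congruence `Φ : U(H₂)(L ⊗ ℝ) ≃ₜ*
U(diag β₀)(L ⊗ ℝ)` acting by `g ↦ T g T⁻¹` (hypothesis `hΦ`, discharged by `fun _ => rfl` for `Ψ_Q`: ★ `coe_archCongrOfEq_quasiSplit_apply`); the `G`-chart point is `Φ⁻¹(gprimeTorus β₀ S′ c′)`.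
Conjugacy in `GL₃(L ⊗ ℝ) = Π_w GL₃(ℂ)` is checked place by place (★ `isConj_iff_forall_place`); at a place both chart components are explicit conjugates of diagonal matrices —
`diag(e^{ic_{τ⁻¹ℓ}})` off the chart set, `K·diag(boostEig c ∘ τ⁻¹)·K⁻¹` on it (★ `coe_gprimeSplitGL_eq_conj_diagonal`) — so `gprimeTorus α S c ↔ gprimeTorus β S′ c′` iff at every place
the eigenvalue triples differ by a permutation (★ `isConj_iff_exists_perm_of_eq_conj_diagonal`): the exact twin of ★ `isArchNormPair_endoTorus_gprimeTorus_iff` with `gprimeTorus` on both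
sides.  THE VANISHING CLAUSE: at a place `w` that is NOT a split-chart place of `α` (house frame `α_i ≠ 0`, `σ_w α_i` real) the three signs `sgn re σ_w α_i` coincide (contrapositive of ★
`mem_splitChartPlaces_of_frame`), so `±σ_w diag α` is positive definite and every `γ′_w ∈ U(σ_w diag α)(ℂ)` has unimodular spectrum (★ `norm_eq_one_of_isRoot_charpoly_of_mem_unitaryGroupOfForm_of_posDef`);
a `β`-chart point split at `w` with `x = c′ w 0 ≠ 0` has the eigenvalue `e^{x+iθ}` of modulus `e^{x} ≠ 1` there, and corresponding elements share place characteristic polynomials (★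
`charpoly_archPiEquivCM_eq_of_corresponds`) — so it has NO partner in `G′_∞`.  Exhaustion (★ (EXH-G′) at `β₀`, every place being a split-chart place of `β₀`) then says: every regular
`γ ∈ G_∞` is `G_∞`-conjugate to a regular chart point `Φ⁻¹(gprimeTorus β₀ S′ c′)`, and if `γ` has a partner then `S′ ⊆` split-chart places of `α`.

* §1 generic (any `N`): `corresponds_arch_iff_forall_place` (two-form twin of ★ (g1)), `corresponds_archCongr_symm_right_iff`;
* §2 two diagonal frames: `exists_coe_gprimeBlock_eq_conj_diagonal`, **`corresponds_gprimeTorus_gprimeTorus_iff`**, `corresponds_gprimeTorus_gprimeTorus`;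
* §3 definite places of `α`: `formSign_eq_of_not_mem_splitChartPlaces`, `posDef_or_posDef_neg_diagonal_formRe_of_not_mem_splitChartPlaces`,
  `norm_eq_one_of_isRoot_charpoly_archPiEquivCM_of_not_mem_splitChartPlaces`, **`not_corresponds_gprimeTorus_of_not_mem_splitChartPlaces`**;
* §4 the quasi-split frame `β₀` through an abstract congruence `Φ`: `mem_splitChartPlaces_quasiSplitWeights`, **`corresponds_gprimeTorus_archCongr_symm_gprimeTorus`** (PARTNER),
  `corresponds_gprimeTorus_archCongr_symm_gprimeTorus_iff`, **`forall_not_corresponds_archCongr_symm_gprimeTorus`** (NO PARTNER = the vanishing clause),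
  `exists_corresponds_archCongr_symm_gprimeTorus_iff` (DICHOTOMY on `RegG`), `exists_conj_archCongr_symm_gprimeTorus_of_isRegularElt` ((EXH) on the `Φ₃` carrier),
  **`exists_conj_archCongr_symm_gprimeTorus_of_corresponds`** (a regular `γ` WITH a partner sits on a chart `S′ ⊆` split-chart places of `α`).
HONEST LABEL: HC_CM is proved only modulo the 7 printed citations (2 remaining: hLiu418 = `stmt-HodgeConjecture-24832`, h413 = `stmt-HodgeConjecture-24833`) until rung 0
closes; chart bookkeeping for the in-house road of row 2 `stub_N8`, count-neutral (+0∕+0).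

## References
* [Rogawski1990] J. D. Rogawski, *Automorphic Representations of Unitary Groups in Three Variables*, Ann. of Math. Stud. 123 (1990), §3.1 p. 19 (stable conjugacy =
  conjugacy in `GL_n`), §3.6 p. 31 (Cartan subgroups of `U(2,1)`, `U(3)`), §14.1 p. 232 (`γ′ ↔ γ`, «`γ` occurs in `G′`»), §14.2 (14.2.1) pp. 232–233 (`S₀`, the vanishing branch).
* [Shelstad1979] D. Shelstad, *Characters and inner forms of a quasi-split group over ℝ*, Compositio Math. 39 (1979), §4 pp. 20–25 (Cartan subgroups of an inner form
  originating in `G`; «`γ′` does not originate in `G`»).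
* [Knapp1986] A. W. Knapp, *Representation Theory of Semisimple Groups* (1986), Ch. V §3 (the two Cartan classes of `SU(2,1)`; the boost and its eigenvectors).
* [HornJohnson2013] R. A. Horn, C. R. Johnson, *Matrix Analysis*, 2nd ed. (2013), Thm. 2.5.6 (unimodular spectrum for a definite form).
-/

set_option autoImplicit false

noncomputable section

open NumberField NumberField.InfinitePlace NumberField.mixedEmbedding Matrix Complex Polynomial
open scoped MatrixGroups Matrix ComplexConjugate Real ComplexOrder Classical

namespace Literature.NumberTheory.Rogawski1990

open Literature.NumberTheory.Automorphic Literature.NumberTheory.Automorphic.UnitaryGroup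

/-! ## §1 Generic: correspondences place by place; correspondences through a congruence; re-indexing permutations -/

section Generic

variable (L : Type) [Field L] [NumberField L] [IsCMField L] {N : ℕ}

/-- **`γ₁ ↔ γ₂` IS CHECKED PLACE BY PLACE**: the correspondence between `U(H₁)(L⁺ ⊗ ℝ)` and `U(H₂)(L⁺ ⊗ ℝ)` (★ `Corresponds`: conjugacy in the common `GL_N(L ⊗ ℝ)`) holds iff the
place components are conjugate in `GL_N(ℂ)` at every complex place — the two-form twin of ★ `isStablyConj_arch_iff_forall_place` (★ `isConj_iff_forall_place`, ★ `coe_archPiEquivCM_apply`).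
[cite: Rogawski1990, §14.1 p. 232; §3.1 p. 19] -/
theorem corresponds_arch_iff_forall_place {H₁ H₂ : Matrix (Fin N) (Fin N) L}
    (γ₁ : arch (↥(maximalRealSubfield L)) L (IsCMField.complexConj L) N H₁) (γ₂ : arch (↥(maximalRealSubfield L)) L (IsCMField.complexConj L) N H₂) :
    Corresponds (conjMixed (↥(maximalRealSubfield L)) L (IsCMField.complexConj L)) (archFormOf L N H₁) (archFormOf L N H₂) γ₁ γ₂ ↔
      ∀ w : {w : InfinitePlace L // IsComplex w},
        IsConj ((archPiEquivCM N L H₁ γ₁ w : archLocal L N H₁ w) : GL (Fin N) ℂ) ((archPiEquivCM N L H₂ γ₂ w : archLocal L N H₂ w) : GL (Fin N) ℂ) := by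
  unfold Corresponds
  rw [isConj_iff_forall_place]
  rfl

variable {H H₂ : Matrix (Fin N) (Fin N) L} (T : GL (Fin N) (mixedSpace L))
  (Φ : arch (↥(maximalRealSubfield L)) L (IsCMField.complexConj L) N H₂ ≃ₜ* arch (↥(maximalRealSubfield L)) L (IsCMField.complexConj L) N H)
  (hΦ : ∀ g : arch (↥(maximalRealSubfield L)) L (IsCMField.complexConj L) N H₂,
    ((Φ g : arch (↥(maximalRealSubfield L)) L (IsCMField.complexConj L) N H) : GL (Fin N) (mixedSpace L)) = T * (g : GL (Fin N) (mixedSpace L)) * T⁻¹)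

include hΦ in
/-- **Correspondences INTO a group read through a congruence `Φ : U(H₂) ≃ U(H)`, `g ↦ T g T⁻¹`**: `γ′ ↔ Φ⁻¹ x` iff `γ′ ↔ x` (★ `corresponds_archCongr_right_iff` at `g := Φ⁻¹ x`) — the
shape in which the `Φ₃`-carrier statements below are read on the diagonal carrier `diag β₀`. [cite: Rogawski1990, §14.1 p. 232] -/
theorem corresponds_archCongr_symm_right_iff {H' : Matrix (Fin N) (Fin N) L} (γ' : arch (↥(maximalRealSubfield L)) L (IsCMField.complexConj L) N H')
    (x : arch (↥(maximalRealSubfield L)) L (IsCMField.complexConj L) N H) :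
    Corresponds (conjMixed (↥(maximalRealSubfield L)) L (IsCMField.complexConj L)) (archFormOf L N H') (archFormOf L N H₂) γ' (Φ.symm x) ↔
      Corresponds (conjMixed (↥(maximalRealSubfield L)) L (IsCMField.complexConj L)) (archFormOf L N H') (archFormOf L N H) γ' x := by
  have h := corresponds_archCongr_right_iff L T Φ hΦ γ' (Φ.symm x)
  rw [ContinuousMulEquiv.apply_symm_apply] at h
  exact h.symm

/-- Re-indexing an `∃ σ`-statement along fixed permutations of both indices. [folklore] -/
private theorem exists_perm_comp_comp_iff {X : Type*} (e f : Equiv.Perm (Fin 3)) (g h : Fin 3 → X) :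
    (∃ σ : Equiv.Perm (Fin 3), ∀ i, g (e i) = h (f (σ i))) ↔ ∃ σ : Equiv.Perm (Fin 3), ∀ i, g i = h (σ i) := by
  constructor
  · rintro ⟨σ, hσ⟩
    refine ⟨e.symm.trans (σ.trans f), fun i => ?_⟩
    rw [Equiv.trans_apply, Equiv.trans_apply, ← hσ (e.symm i), Equiv.apply_symm_apply]
  · rintro ⟨σ, hσ⟩
    refine ⟨e.trans (σ.trans f.symm), fun i => ?_⟩
    rw [Equiv.trans_apply, Equiv.trans_apply, Equiv.apply_symm_apply, hσ (e i)]

end Generic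

/-! ## §2 Two diagonal frames: `gprimeTorus α S c ↔ gprimeTorus β S′ c′` place by place -/

section TwoFrames

variable (L : Type) [Field L] [NumberField L] [IsCMField L]

omit [NumberField L] [IsCMField L] in
/-- **Every place component of a chart point is an explicit conjugate of a diagonal** — `diag(boostEig c ∘ τ⁻¹)` under the re-indexed eigenvector matrix `cayB` on the chart set
(★ `coe_gprimeSplitGL_eq_conj_diagonal`, `S ⊆` split-chart places), the unit diagonal `diag(e^{ic_{τ⁻¹ℓ}})` (conjugator `1`) off it; `τ = lineOf (formSign L α w)`.  (The `hY` block
of ★ `isArchNormPair_endoTorus_gprimeTorus_iff`, recorded once for both frames.) [cite: Knapp1986, Ch. V §3] [cite: Rogawski1990, §3.6 p. 31] -/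
theorem exists_coe_gprimeBlock_eq_conj_diagonal (α : Fin 3 → L) (S : Finset {w : InfinitePlace L // IsComplex w})
    (c : {w : InfinitePlace L // IsComplex w} → Fin 3 → ℝ) (hS : ∀ w, w ∈ S → w ∈ splitChartPlaces L α) (w : {w : InfinitePlace L // IsComplex w}) :
    ∃ T : Matrix (Fin 3) (Fin 3) ℂ, IsUnit T.det ∧ ((gprimeBlock L α w S c : GL (Fin 3) ℂ) : Matrix (Fin 3) (Fin 3) ℂ) =
      T * Matrix.diagonal (fun i => (if w ∈ S then boostEig (c w) else fun i => Complex.exp ((c w i : ℂ) * I)) ((lineOf (formSign L α w)).symm i)) * T⁻¹ := by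
  by_cases hw : w ∈ S
  · refine ⟨(cayB (formRe L α w ∘ lineOf (formSign L α w))).submatrix (lineOf (formSign L α w)).symm (lineOf (formSign L α w)).symm,
      isUnit_det_cayB_submatrix (lineOf (formSign L α w)) _ (hS w hw).2, ?_⟩
    rw [if_pos hw, coe_gprimeBlock_of_mem L α c hw (hS w hw)]
    exact coe_gprimeSplitGL_eq_conj_diagonal (lineOf (formSign L α w)) _ (hS w hw).2 (c w)
  · refine ⟨1, by rw [Matrix.det_one]; exact isUnit_one, ?_⟩
    rw [if_neg hw, coe_gprimeBlock_of_not_mem L α c hw, coe_gprimeCptGL, inv_one, Matrix.one_mul, Matrix.mul_one]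

variable (α β : Fin 3 → L) (S S' : Finset {w : InfinitePlace L // IsComplex w}) (c c' : {w : InfinitePlace L // IsComplex w} → Fin 3 → ℝ)

/-- **THE TWO-FRAME DICTIONARY, PLACE BY PLACE**: for chart sets `S ⊆` split-chart places of `α` and `S′ ⊆` split-chart places of `β`, `gprimeTorus α S c ↔ gprimeTorus β S′ c′`
(★ `Corresponds (c ⊗ 1) (diag α ⊗ 1) (diag β ⊗ 1)`: conjugate in `GL₃(L ⊗ ℝ)`) iff at every complex place the eigenvalue triple of the `β`-chart point is a permutation of that of
the `α`-chart point — `boostEig (c w) = (e^{x+iθ}, e^{iφ}, e^{−x+iθ})` on the chart set, `(e^{ic_i})_i` off it.  No regularity hypothesis.  (★ `isArchNormPair_endoTorus_gprimeTorus_iff` with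
`gprimeTorus` on both sides.) [cite: Rogawski1990, §14.1 p. 232; §3.1 p. 19; §3.6 p. 31] [cite: Shelstad1979, §4 p. 22] -/
theorem corresponds_gprimeTorus_gprimeTorus_iff (hS : ∀ w, w ∈ S → w ∈ splitChartPlaces L α) (hS' : ∀ w, w ∈ S' → w ∈ splitChartPlaces L β) :
    Corresponds (conjMixed (↥(maximalRealSubfield L)) L (IsCMField.complexConj L)) (archFormOf L 3 (Matrix.diagonal α)) (archFormOf L 3 (Matrix.diagonal β))
        (gprimeTorus L α S c) (gprimeTorus L β S' c') ↔
      ∀ w : {w : InfinitePlace L // IsComplex w}, ∃ σ : Equiv.Perm (Fin 3), ∀ i : Fin 3,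
        (if w ∈ S' then boostEig (c' w) else fun i => Complex.exp ((c' w i : ℂ) * I)) i =
          (if w ∈ S then boostEig (c w) else fun i => Complex.exp ((c w i : ℂ) * I)) (σ i) := by
  rw [corresponds_arch_iff_forall_place]
  refine forall_congr' fun w => ?_
  rw [archPiEquivCM_gprimeTorus, archPiEquivCM_gprimeTorus]
  obtain ⟨Tα, hTα, hA⟩ := exists_coe_gprimeBlock_eq_conj_diagonal L α S c hS w
  obtain ⟨Tβ, hTβ, hB⟩ := exists_coe_gprimeBlock_eq_conj_diagonal L β S' c' hS' w
  rw [isConj_units_iff_coe, isConj_iff_exists_perm_of_eq_conj_diagonal hTα hTβ hA hB]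
  exact exists_perm_comp_comp_iff (lineOf (formSign L β w)).symm (lineOf (formSign L α w)).symm _ _

/-- **SAME CHART TYPE, SAME COORDINATES ⇒ PARTNERS**: for `S ⊆` split-chart places of both `α` and `β`, `gprimeTorus α S c ↔ gprimeTorus β S c` (`σ = 1` place by place).
[cite: Rogawski1990, §14.1 p. 232] [cite: Shelstad1979, §4 p. 22] -/
theorem corresponds_gprimeTorus_gprimeTorus (hSα : ∀ w, w ∈ S → w ∈ splitChartPlaces L α) (hSβ : ∀ w, w ∈ S → w ∈ splitChartPlaces L β) :
    Corresponds (conjMixed (↥(maximalRealSubfield L)) L (IsCMField.complexConj L)) (archFormOf L 3 (Matrix.diagonal α)) (archFormOf L 3 (Matrix.diagonal β))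
      (gprimeTorus L α S c) (gprimeTorus L β S c) := by
  rw [corresponds_gprimeTorus_gprimeTorus_iff L α β S S c c hSα hSβ]
  exact fun w => ⟨1, fun i => rfl⟩

end TwoFrames

/-! ## §3 Definite places of `α`: unimodular spectrum, no partner for a split chart point -/

section Definite

variable (L : Type) [Field L] [NumberField L] [IsCMField L] {α : Fin 3 → L} {w : {w : InfinitePlace L // IsComplex w}}

omit [NumberField L] [IsCMField L] in
/-- **Off the split-chart places the three signs coincide** (house frame `α_i ≠ 0`, `σ_w α_i` real): contrapositive of ★ `mem_splitChartPlaces_of_frame`. [cite: Rogawski1990, §3.6 p. 31] -/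
theorem formSign_eq_of_not_mem_splitChartPlaces (hα : ∀ i, α i ≠ 0) (hreal : ∀ i, (w.1.embedding (α i)).im = 0) (hw : w ∉ splitChartPlaces L α) :
    formSign L α w 0 = formSign L α w 1 ∧ formSign L α w 1 = formSign L α w 2 := by
  by_contra h
  exact hw (mem_splitChartPlaces_of_frame hα hreal h)

omit [NumberField L] [IsCMField L] in
/-- **… so `±diag(re σ_w α)` is positive definite there**: the place form `diag(formRe L α w)` of `G′_w` (★ `mem_unitaryGroupOfForm_formRe_of_mem_archLocal`) is definite.
[cite: Rogawski1990, §3.6 p. 31; §14.2 p. 232] [cite: HornJohnson2013, Thm. 2.5.6] -/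
theorem posDef_or_posDef_neg_diagonal_formRe_of_not_mem_splitChartPlaces (hα : ∀ i, α i ≠ 0) (hreal : ∀ i, (w.1.embedding (α i)).im = 0)
    (hw : w ∉ splitChartPlaces L α) :
    (Matrix.diagonal fun i => ((formRe L α w i : ℝ) : ℂ)).PosDef ∨ (-(Matrix.diagonal fun i => ((formRe L α w i : ℝ) : ℂ))).PosDef := by
  obtain ⟨h01, h12⟩ := formSign_eq_of_not_mem_splitChartPlaces L hα hreal hw
  have hne : ∀ i, formRe L α w i ≠ 0 := formRe_ne_zero hα hreal
  have hs' : ∀ i : Fin 3, formSign L α w i = formSign L α w 0 := by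
    intro i
    fin_cases i
    · rfl
    · exact h01.symm
    · exact (h01.trans h12).symm
  have hs : ∀ i : Fin 3, SignType.sign (formRe L α w i) = SignType.sign (formRe L α w 0) := fun i => hs' i
  rcases lt_or_gt_of_ne (hne 0) with h0 | h0
  · right
    rw [Matrix.diagonal_neg]
    refine Matrix.PosDef.diagonal fun i => ?_
    have hi : formRe L α w i < 0 := by
      have h := hs i
      rw [sign_neg h0] at h
      exact sign_eq_neg_one_iff.1 h
    rw [← Complex.ofReal_neg]
    exact Complex.zero_lt_real.2 (neg_pos.2 hi)
  · left
    refine Matrix.PosDef.diagonal fun i => ?_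
    have hi : 0 < formRe L α w i := by
      have h := hs i
      rw [sign_pos h0] at h
      exact sign_eq_one_iff.1 h
    exact Complex.zero_lt_real.2 hi

/-- **DEFINITE PLACES HAVE UNIMODULAR SPECTRUM**: at a place `w` that is not a split-chart place of `α` (house frame) every characteristic root of every `γ′_w ∈ G′_w = U(σ_w diag α)(ℂ)`
has absolute value `1` (★ `norm_eq_one_of_isRoot_charpoly_of_mem_unitaryGroupOfForm_of_posDef ∕ _of_neg_posDef`). [cite: HornJohnson2013, Thm. 2.5.6] [cite: Rogawski1990, §14.2 p. 232; §3.1 p. 19] -/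
theorem norm_eq_one_of_isRoot_charpoly_archPiEquivCM_of_not_mem_splitChartPlaces (hα : ∀ i, α i ≠ 0) (hreal : ∀ i, (w.1.embedding (α i)).im = 0)
    (hw : w ∉ splitChartPlaces L α) (γ' : arch (↥(maximalRealSubfield L)) L (IsCMField.complexConj L) 3 (Matrix.diagonal α)) {z : ℂ}
    (hz : (((archPiEquivCM 3 L (Matrix.diagonal α) γ' w : archLocal L 3 (Matrix.diagonal α) w) : GL (Fin 3) ℂ) : Matrix (Fin 3) (Fin 3) ℂ).charpoly.IsRoot z) :
    ‖z‖ = 1 := by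
  have hmem : ((archPiEquivCM 3 L (Matrix.diagonal α) γ' w : archLocal L 3 (Matrix.diagonal α) w) : GL (Fin 3) ℂ) ∈
      unitaryGroupOfForm (starRingEnd ℂ) (Matrix.diagonal fun i => ((formRe L α w i : ℝ) : ℂ)) :=
    mem_unitaryGroupOfForm_formRe_of_mem_archLocal L α hreal (archPiEquivCM 3 L (Matrix.diagonal α) γ' w).2
  rcases posDef_or_posDef_neg_diagonal_formRe_of_not_mem_splitChartPlaces L hα hreal hw with h | h
  · exact norm_eq_one_of_isRoot_charpoly_of_mem_unitaryGroupOfForm_of_posDef h hmem hz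
  · exact norm_eq_one_of_isRoot_charpoly_of_mem_unitaryGroupOfForm_of_neg_posDef h hmem hz

/-- **NO PARTNER AT A DEFINITE PLACE (two diagonal frames)**: a `β`-chart point split at a place `w ∈ S′` with `x_w = c′ w 0 ≠ 0`, `w` a split-chart place of `β` but NOT of `α`
(house frame of `α` at `w`), corresponds to NO `γ′ ∈ U(diag α)(L⁺ ⊗ ℝ)`: a partner would have the characteristic polynomial of the boost at `w` (★ `charpoly_archPiEquivCM_eq_of_corresponds`,
★ `charpoly_gprimeSplitMatrix`), whose root `e^{x+iθ}` has modulus `e^{x} ≠ 1`, against the unimodular spectrum of `G′_w`. [cite: Rogawski1990, §14.2 pp. 232–233; §3.6 p. 31]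
[cite: Shelstad1979, §4 p. 22] -/
theorem not_corresponds_gprimeTorus_of_not_mem_splitChartPlaces {β : Fin 3 → L} (hα : ∀ i, α i ≠ 0) (hreal : ∀ i, (w.1.embedding (α i)).im = 0)
    {S' : Finset {w : InfinitePlace L // IsComplex w}} {c' : {w : InfinitePlace L // IsComplex w} → Fin 3 → ℝ}
    (hw : w ∈ S') (hwα : w ∉ splitChartPlaces L α) (hwβ : w ∈ splitChartPlaces L β) (hx : c' w 0 ≠ 0)
    (γ' : arch (↥(maximalRealSubfield L)) L (IsCMField.complexConj L) 3 (Matrix.diagonal α)) :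
    ¬ Corresponds (conjMixed (↥(maximalRealSubfield L)) L (IsCMField.complexConj L)) (archFormOf L 3 (Matrix.diagonal α)) (archFormOf L 3 (Matrix.diagonal β))
      γ' (gprimeTorus L β S' c') := by
  intro h
  have hchar := charpoly_archPiEquivCM_eq_of_corresponds L h w
  rw [archPiEquivCM_gprimeTorus, coe_gprimeBlock_of_mem L β c' hw hwβ, coe_gprimeSplitGL, charpoly_gprimeSplitMatrix _ _ hwβ.2] at hchar
  have hroot : (((archPiEquivCM 3 L (Matrix.diagonal α) γ' w : archLocal L 3 (Matrix.diagonal α) w) : GL (Fin 3) ℂ) : Matrix (Fin 3) (Fin 3) ℂ).charpoly.IsRoot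
      (boostEig (c' w) 0) := by
    rw [hchar, Polynomial.IsRoot, Polynomial.eval_prod]
    exact Finset.prod_eq_zero (Finset.mem_univ (0 : Fin 3)) (by rw [Polynomial.eval_sub, Polynomial.eval_X, Polynomial.eval_C, sub_self])
  have h1 := norm_eq_one_of_isRoot_charpoly_archPiEquivCM_of_not_mem_splitChartPlaces L hα hreal hwα γ' hroot
  have h2 : ‖boostEig (c' w) 0‖ = Real.exp (c' w 0) := by
    show ‖Complex.exp ((c' w 0 : ℂ) + (c' w 2 : ℂ) * I)‖ = Real.exp (c' w 0)
    exact norm_exp_ofReal_add_ofReal_mul_I (c' w 0) (c' w 2)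
  rw [h2, Real.exp_eq_one_iff] at h1
  exact hx h1

end Definite

/-! ## §4 The quasi-split frame `β₀ = (½, 1, −½)` read on the `Φ₃` carrier through a congruence `Φ`, `g ↦ T g T⁻¹` -/

section QuasiSplit

variable (L : Type) [Field L] [NumberField L] [IsCMField L]

omit [IsCMField L] in
/-- **EVERY COMPLEX PLACE IS A SPLIT-CHART PLACE OF `β₀ = (½, 1, −½)`** (★ `quasiSplitWeights_ne_zero`, ★ `im_embedding_quasiSplitWeights_eq_zero`, ★ `re_embedding_quasiSplitWeights`:
the signs `(+, +, −)` are not all equal; ★ `mem_splitChartPlaces_of_frame`). [cite: Rogawski1990, §14.1 p. 232; §3.6 p. 31] -/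
theorem mem_splitChartPlaces_quasiSplitWeights (w : {w : InfinitePlace L // IsComplex w}) : w ∈ splitChartPlaces L ![(2 : L)⁻¹, 1, -(2 : L)⁻¹] := by
  refine mem_splitChartPlaces_of_frame (quasiSplitWeights_ne_zero L) (im_embedding_quasiSplitWeights_eq_zero L w) ?_
  rintro ⟨h01, h12⟩
  have h0 : formSign L ![(2 : L)⁻¹, 1, -(2 : L)⁻¹] w 0 = 1 := by
    show SignType.sign ((w.1.embedding ((![(2 : L)⁻¹, 1, -(2 : L)⁻¹]) 0)).re) = 1
    rw [re_embedding_quasiSplitWeights]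
    exact sign_pos (by simp only [Matrix.cons_val_zero]; norm_num)
  have h2 : formSign L ![(2 : L)⁻¹, 1, -(2 : L)⁻¹] w 2 = -1 := by
    show SignType.sign ((w.1.embedding ((![(2 : L)⁻¹, 1, -(2 : L)⁻¹]) 2)).re) = -1
    rw [re_embedding_quasiSplitWeights]
    exact sign_neg (by simp only [Matrix.cons_val_two, Matrix.tail_cons, Matrix.head_cons]; norm_num)
  have h := h01.trans h12
  rw [h0, h2] at h
  exact absurd h (by decide)

variable {H₂ : Matrix (Fin 3) (Fin 3) L} (T : GL (Fin 3) (mixedSpace L))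
  (Φ : arch (↥(maximalRealSubfield L)) L (IsCMField.complexConj L) 3 H₂ ≃ₜ*
    arch (↥(maximalRealSubfield L)) L (IsCMField.complexConj L) 3 (Matrix.diagonal ![(2 : L)⁻¹, 1, -(2 : L)⁻¹]))
  (hΦ : ∀ g : arch (↥(maximalRealSubfield L)) L (IsCMField.complexConj L) 3 H₂,
    ((Φ g : arch (↥(maximalRealSubfield L)) L (IsCMField.complexConj L) 3 (Matrix.diagonal ![(2 : L)⁻¹, 1, -(2 : L)⁻¹])) : GL (Fin 3) (mixedSpace L)) =
      T * (g : GL (Fin 3) (mixedSpace L)) * T⁻¹)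
  {α : Fin 3 → L}

include hΦ in
/-- **(H1) PARTNER**: for `S′ ⊆` split-chart places of `α`, the `α`-chart point with the SAME coordinates corresponds to the `G`-chart point `Φ⁻¹(gprimeTorus β₀ S′ c′)` of `U(H₂)(L⁺ ⊗ ℝ)`
(`H₂ = Φ₃`, `Φ = Ψ_Q` for (14.2.1)): branch (i)'s witness; every other partner is stably conjugate to it (★ `Corresponds.isStablyConj_left`). [cite: Rogawski1990, §14.1 p. 232; §14.2 (14.2.1) p. 232]
[cite: Shelstad1979, §4 p. 22] -/
theorem corresponds_gprimeTorus_archCongr_symm_gprimeTorus {S' : Finset {w : InfinitePlace L // IsComplex w}} (hS : ∀ w, w ∈ S' → w ∈ splitChartPlaces L α)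
    (c' : {w : InfinitePlace L // IsComplex w} → Fin 3 → ℝ) :
    Corresponds (conjMixed (↥(maximalRealSubfield L)) L (IsCMField.complexConj L)) (archFormOf L 3 (Matrix.diagonal α)) (archFormOf L 3 H₂)
      (gprimeTorus L α S' c') (Φ.symm (gprimeTorus L ![(2 : L)⁻¹, 1, -(2 : L)⁻¹] S' c')) := by
  rw [corresponds_archCongr_symm_right_iff L T Φ hΦ]
  exact corresponds_gprimeTorus_gprimeTorus L α _ S' c' hS (fun w _ => mem_splitChartPlaces_quasiSplitWeights L w)

include hΦ in
/-- **(H1′) WHICH `α`-CHART POINTS ARE PARTNERS of `Φ⁻¹(gprimeTorus β₀ S′ c′)`**: `gprimeTorus α S c ↔ Φ⁻¹(gprimeTorus β₀ S′ c′)` iff at every place the eigenvalue triples differ by a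
permutation (§2 read through `Φ`) — the index bookkeeping the READ-G ∕ FORWARD bricks sum over. [cite: Rogawski1990, §14.1 p. 232; §4.3 p. 42] [cite: Shelstad1979, §4 p. 22] -/
theorem corresponds_gprimeTorus_archCongr_symm_gprimeTorus_iff {S : Finset {w : InfinitePlace L // IsComplex w}} (hS : ∀ w, w ∈ S → w ∈ splitChartPlaces L α)
    (c : {w : InfinitePlace L // IsComplex w} → Fin 3 → ℝ) (S' : Finset {w : InfinitePlace L // IsComplex w}) (c' : {w : InfinitePlace L // IsComplex w} → Fin 3 → ℝ) :
    Corresponds (conjMixed (↥(maximalRealSubfield L)) L (IsCMField.complexConj L)) (archFormOf L 3 (Matrix.diagonal α)) (archFormOf L 3 H₂)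
        (gprimeTorus L α S c) (Φ.symm (gprimeTorus L ![(2 : L)⁻¹, 1, -(2 : L)⁻¹] S' c')) ↔
      ∀ w : {w : InfinitePlace L // IsComplex w}, ∃ σ : Equiv.Perm (Fin 3), ∀ i : Fin 3,
        (if w ∈ S' then boostEig (c' w) else fun i => Complex.exp ((c' w i : ℂ) * I)) i =
          (if w ∈ S then boostEig (c w) else fun i => Complex.exp ((c w i : ℂ) * I)) (σ i) := by
  rw [corresponds_archCongr_symm_right_iff L T Φ hΦ]
  exact corresponds_gprimeTorus_gprimeTorus_iff L α _ S S' c c' hS (fun w _ => mem_splitChartPlaces_quasiSplitWeights L w)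

include hΦ in
/-- **(H2) NO PARTNER — THE VANISHING CLAUSE of (14.2.1)**: if the chart set `S′` contains a place `w` that is NOT a split-chart place of `α` (a definite place of the inner form, house
frame at `w`) and `x_w = c′ w 0 ≠ 0`, then NO `γ′ ∈ G′_∞ = U(diag α)(L⁺ ⊗ ℝ)` corresponds to the `G`-chart point `Φ⁻¹(gprimeTorus β₀ S′ c′)` («`γ` does not occur in `G′`»: `γ` is hyperbolic
at a place where `G′_w ≅ U(3)` is compact), so branch (ii) applies: `Φ^st(γ, a) = 0`. [cite: Rogawski1990, §14.2 (14.2.1) pp. 232–233; §14.1 p. 232] [cite: Shelstad1979, §4 p. 22] -/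
theorem forall_not_corresponds_archCongr_symm_gprimeTorus (hα : ∀ i, α i ≠ 0) {w : {w : InfinitePlace L // IsComplex w}} (hreal : ∀ i, (w.1.embedding (α i)).im = 0)
    {S' : Finset {w : InfinitePlace L // IsComplex w}} {c' : {w : InfinitePlace L // IsComplex w} → Fin 3 → ℝ}
    (hw : w ∈ S') (hwα : w ∉ splitChartPlaces L α) (hx : c' w 0 ≠ 0) :
    ∀ γ' : arch (↥(maximalRealSubfield L)) L (IsCMField.complexConj L) 3 (Matrix.diagonal α),
      ¬ Corresponds (conjMixed (↥(maximalRealSubfield L)) L (IsCMField.complexConj L)) (archFormOf L 3 (Matrix.diagonal α)) (archFormOf L 3 H₂)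
        γ' (Φ.symm (gprimeTorus L ![(2 : L)⁻¹, 1, -(2 : L)⁻¹] S' c')) := fun γ' h =>
  not_corresponds_gprimeTorus_of_not_mem_splitChartPlaces L hα hreal hw hwα (mem_splitChartPlaces_quasiSplitWeights L w) hx γ'
    ((corresponds_archCongr_symm_right_iff L T Φ hΦ _ _).1 h)

include hΦ in
/-- **(H3) DICHOTOMY ON THE REGULAR SET**: for regular coordinates `c′ ∈ RegG S′` (so `x_w ≠ 0` on `S′`) and the house frame of `α`, the `G`-chart point `Φ⁻¹(gprimeTorus β₀ S′ c′)` occurs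
in `G′_∞` iff `S′ ⊆` split-chart places of `α` ((H1) ⇐, (H2) ⇒). [cite: Rogawski1990, §14.1 p. 232; §14.2 pp. 232–233] [cite: Shelstad1979, §4 pp. 22–25] -/
theorem exists_corresponds_archCongr_symm_gprimeTorus_iff (hα : ∀ i, α i ≠ 0)
    (hreal : ∀ (w : {w : InfinitePlace L // IsComplex w}) (i : Fin 3), (w.1.embedding (α i)).im = 0)
    {S' : Finset {w : InfinitePlace L // IsComplex w}} {c' : {w : InfinitePlace L // IsComplex w} → Fin 3 → ℝ} (hc' : c' ∈ ArchCartan.RegG S') :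
    (∃ γ' : arch (↥(maximalRealSubfield L)) L (IsCMField.complexConj L) 3 (Matrix.diagonal α),
        Corresponds (conjMixed (↥(maximalRealSubfield L)) L (IsCMField.complexConj L)) (archFormOf L 3 (Matrix.diagonal α)) (archFormOf L 3 H₂)
          γ' (Φ.symm (gprimeTorus L ![(2 : L)⁻¹, 1, -(2 : L)⁻¹] S' c'))) ↔
      ∀ w, w ∈ S' → w ∈ splitChartPlaces L α := by
  constructor
  · rintro ⟨γ', h⟩ w hw
    by_contra hwα
    exact forall_not_corresponds_archCongr_symm_gprimeTorus L T Φ hΦ hα (hreal w) hw hwα (((ArchCartan.mem_regG_iff S' c').1 hc').2 w hw) γ' h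
  · intro hS
    exact ⟨gprimeTorus L α S' c', corresponds_gprimeTorus_archCongr_symm_gprimeTorus L T Φ hΦ hS c'⟩

include hΦ in
/-- **(EXH) ON THE `Φ₃` CARRIER**: every regular `γ ∈ U(H₂)(L⁺ ⊗ ℝ)` (`H₂ = Φ₃`: `G_∞`) is `U(H₂)`-conjugate to a regular `G`-chart point `Φ⁻¹(gprimeTorus β₀ S′ c′)`, `c′ ∈ RegG S′` (★ (EXH-G′)
`exists_conj_gprimeTorus_of_isRegularElt` at `β₀`, whose frame guards are ★; regularity through `Φ` by ★ `isRegularElt_coe_archCongr_iff`). [cite: Rogawski1990, §3.6 p. 31; §3.1 p. 19]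
[cite: Knapp1986, Ch. V §3] -/
theorem exists_conj_archCongr_symm_gprimeTorus_of_isRegularElt (γ : arch (↥(maximalRealSubfield L)) L (IsCMField.complexConj L) 3 H₂)
    (hreg : IsRegularElt (γ : GL (Fin 3) (mixedSpace L))) :
    ∃ (S' : Finset {w : InfinitePlace L // IsComplex w}) (c' : {w : InfinitePlace L // IsComplex w} → Fin 3 → ℝ)
      (g : arch (↥(maximalRealSubfield L)) L (IsCMField.complexConj L) 3 H₂),
      c' ∈ ArchCartan.RegG S' ∧ γ = g * Φ.symm (gprimeTorus L ![(2 : L)⁻¹, 1, -(2 : L)⁻¹] S' c') * g⁻¹ := by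
  have hreg' : IsRegularElt ((Φ γ : arch (↥(maximalRealSubfield L)) L (IsCMField.complexConj L) 3 (Matrix.diagonal ![(2 : L)⁻¹, 1, -(2 : L)⁻¹])) :
      GL (Fin 3) (mixedSpace L)) :=
    (isRegularElt_coe_archCongr_iff L T Φ hΦ γ).2 hreg
  obtain ⟨S', c', g, -, hc', hconj⟩ := exists_conj_gprimeTorus_of_isRegularElt L _ (quasiSplitWeights_ne_zero L) (im_embedding_quasiSplitWeights_eq_zero L) (Φ γ) hreg'
  refine ⟨S', c', Φ.symm g, hc', Φ.injective ?_⟩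
  rw [map_mul, map_mul, map_inv, ContinuousMulEquiv.apply_symm_apply, ContinuousMulEquiv.apply_symm_apply]
  exact hconj

include hΦ in
/-- **(head (c)) A REGULAR `γ ∈ G_∞` WITH A PARTNER LIES ON A CHART `S′ ⊆` SPLIT-CHART PLACES OF `α`**: if `γ′ ↔ γ` for some `γ′ ∈ U(diag α)(L⁺ ⊗ ℝ)` (house frame of `α`) and `γ ∈ U(H₂)(L⁺ ⊗ ℝ)`
is regular, then `γ = g · Φ⁻¹(gprimeTorus β₀ S′ c′) · g⁻¹` with `c′ ∈ RegG S′` and `S′ ⊆` split-chart places of `α` ((EXH) + (H2): the correspondence only sees the stable class of `γ`,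
★ `Corresponds.of_isStablyConj_right`). [cite: Rogawski1990, §14.1 p. 232; §14.2 pp. 232–233; §3.6 p. 31] [cite: Shelstad1979, §4 pp. 22–25] -/
theorem exists_conj_archCongr_symm_gprimeTorus_of_corresponds (hα : ∀ i, α i ≠ 0)
    (hreal : ∀ (w : {w : InfinitePlace L // IsComplex w}) (i : Fin 3), (w.1.embedding (α i)).im = 0)
    (γ : arch (↥(maximalRealSubfield L)) L (IsCMField.complexConj L) 3 H₂) (hreg : IsRegularElt (γ : GL (Fin 3) (mixedSpace L)))
    (γ' : arch (↥(maximalRealSubfield L)) L (IsCMField.complexConj L) 3 (Matrix.diagonal α))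
    (h : Corresponds (conjMixed (↥(maximalRealSubfield L)) L (IsCMField.complexConj L)) (archFormOf L 3 (Matrix.diagonal α)) (archFormOf L 3 H₂) γ' γ) :
    ∃ (S' : Finset {w : InfinitePlace L // IsComplex w}) (c' : {w : InfinitePlace L // IsComplex w} → Fin 3 → ℝ)
      (g : arch (↥(maximalRealSubfield L)) L (IsCMField.complexConj L) 3 H₂),
      (∀ w, w ∈ S' → w ∈ splitChartPlaces L α) ∧ c' ∈ ArchCartan.RegG S' ∧ γ = g * Φ.symm (gprimeTorus L ![(2 : L)⁻¹, 1, -(2 : L)⁻¹] S' c') * g⁻¹ := by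
  obtain ⟨S', c', g, hc', hconj⟩ := exists_conj_archCongr_symm_gprimeTorus_of_isRegularElt L T Φ hΦ γ hreg
  refine ⟨S', c', g, ?_, hc', hconj⟩
  have hγx : IsConj γ (Φ.symm (gprimeTorus L ![(2 : L)⁻¹, 1, -(2 : L)⁻¹] S' c')) := (isConj_iff.2 ⟨g, hconj.symm⟩).symm
  have hx : Corresponds (conjMixed (↥(maximalRealSubfield L)) L (IsCMField.complexConj L)) (archFormOf L 3 (Matrix.diagonal α)) (archFormOf L 3 H₂)
      γ' (Φ.symm (gprimeTorus L ![(2 : L)⁻¹, 1, -(2 : L)⁻¹] S' c')) :=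
    h.of_isStablyConj_right (isStablyConj_arch_of_isConj L 3 H₂ hγx)
  exact (exists_corresponds_archCongr_symm_gprimeTorus_iff L T Φ hΦ hα hreal hc').1 ⟨γ', hx⟩

end QuasiSplit

end Literature.NumberTheory.Rogawski1990

end
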